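import Summits.QuantumFields.BalabanUV.T4Continuum.Support.NE7CurlGradientReading
import Summits.QuantumFields.BalabanUV.T4Continuum.Support.NE7EtaRatesD4Cov
import Summits.QuantumFields.BalabanUV.T4Continuum.Support.NE7EtaClosenessHolder
import Summits.QuantumFields.BalabanUV.T4Continuum.Support.NE7SliceStepErrorField
import Summits.QuantumFields.BalabanUV.T4Continuum.Support.BlockAverageCurrent
import HarnessLib

/-!
# NE7PairCurlSupRate — supplier stub (S-g′) of the NE7 crux, part 3 (ROAD-G108 §1): THE SUP OF THE DRESSED CURL OF A PAIR COORDINATE AT THE RATE `θ^{42k}` FROM (E), THE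
# REGULARITY RADII OF THE PAIR AND A COVARIANT-GRADIENT LETTER `α₁` — (S-b) `norm_curlGrad_le_of_radii` ∘ gen 22's local-average lemma `norm_curl_le_rate_cov`

Cell `pub-balaban`, rung (B)+1 sub-cell t4, lineage `b2b-balaban-t4-ne7-p1`, generation 108 (CRUX PROVER NE7 #1 = OWNER of BINDER row NE7).  Memo `t4/b2b-balaban-t4-ne7-p1-g108/ROAD-G108.md` §1.
SETTING (`d = 4`, `L = 2`, level `k = j+1`, `M = 2^{j+1}`, `ξ = M⁻¹ = θ^{18k}`).  `W` unitary `(N·M)`-periodic with `SmallField W (ε∕M²)`; `X` skew `(N·M)`-periodic, `‖X‖ ≤ α`, `αM ≤ C_S ε`,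
`C_S ε ≤ 1∕48`, `SmallField (W e^X) (ε∕M²)`; the plaquette-GRADIENT radii of the pair in the currency of `MinimalActionRefine.RegularSup` ∕ `NE3AveragedGradientRadius`:
`x₁(W) ≤ 2(c + curConst·ε²)∕M³`, `x₁(W e^X) ≤ 2c∕M³`; (E) in the budget form `M·‖X‖_w ≤ γ³`; and a covariant-gradient letter `‖Ad_{W(y+e_κ,τ)}X(y+e_τ,κ) − X(y,κ)‖ ≤ α₁`.
THE LETTER.  (S-b) (`NE7CurlGradientReading.norm_curlGrad_le_of_radii`) gives the curl's covariant Lipschitz letter `≤ (Λ₂⁰ + 128·C_Sε·M²·α₁)∕M³` with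
`Λ₂⁰ = 10c + 6·curConst·ε² + 8C_Sε·ε + 4096(C_Sε)²ε + 1330(C_Sε)³`; for any `l₂ ≥ γ` with `Λ₂⁰ + 128C_Sε·M²·α₁ ≤ l₂³` gen 22's local-average lemma
(`NE7EtaRatesD4Cov.norm_curl_le_rate_cov` at `θ₆ := θ³`; the fit `γθ^{6k} ≤ l₂N` is automatic from `γ ≤ l₂`) yields **`sup‖curl_W X‖ ≤ 8l₂²γ·θ^{42k}`** — the bootstrap quantity
`α₁` enters ONLY through the cube root `l₂`.
WHAT ([folklore]; 0 def, 0 sorry).  **`curl_lipschitz_of_radii`** (the Lipschitz letter in the `∕M³` currency), **`curl_sup_rate`**.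
HONEST FRAMING (page 1): lattice kinematics [folklore] over landed kernel theorems; the radii are HYPOTHESES of the TYPE of [Balaban1985Variational] Thm 1 (10) (asserted for no minimiser
here); NOT (Gᶜ_w) (next file), NOT NE3∕NE7; spine count unchanged; finite T⁴ rung (B)+1 — NOT infinite volume, NOT mass gap, NOT BetaPertH, NOT Clay.
-/

set_option autoImplicit false

open scoped BigOperators Matrix Matrix.Norms.L2Operator
open Finset NormedSpace Set

namespace Summit.QuantumFields.BalabanUV.T4Continuum.NE7PairCurlSupRate

open Literature.MathematicalPhysics.QuantumFieldTheory.Balaban1983to89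
open B7Prop1Explicit B7Prop2Explicit
open T4AveragingDeficitWall hiding Site Plane Plaq Bond
open T4AveragingDeficitWallBoundary (periodBox IsPeriodicCfg)
open AveragingDeficitPeriodicCounting (IsPeriodicDir)
open NE3EnergyWeightedShapes (energyNormW energyNormW_nonneg)
open BlockAverageCurrent (curConst curConst_nonneg)
open NE7CurlGradientReading (norm_curlGrad_le_of_radii)
open NE7EtaRatesD4Cov (norm_curl_le_rate_cov)
open NE7EtaClosenessHolder (theta18_lt_one)
open NE7SliceStepErrorField (norm_curlAt_le_of_plaq)

noncomputable section

variable {n : Type*} [Fintype n] [DecidableEq n]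

/-! ## §1 The curl's covariant Lipschitz letter from the radii of the pair

The `α₁`-free part of the Lipschitz constant is `Λ₂⁰(c, ε, C_Sε) := 10c + 6·curConst 4 2·ε² + 8·C_Sε·ε + 4096·C_Sε²·ε + 1330·C_Sε³` (spelled out; no definition). -/

/-- **THE CURL's COVARIANT LIPSCHITZ LETTER FROM THE RADII OF THE PAIR** (`M > 0` any real scale here): with `‖X‖ ≤ α`, `αM ≤ C_Sε ≤ 1∕48`, `SmallField W (ε∕M²)`,
`SmallField (W e^X) (ε∕M²)`, `0 ≤ ε`, `1 ≤ M`, the plaquette-gradient radii `2(c + curConst ε²)∕M³` (of `W`) and `2c∕M³` (of `W e^X`), and the covariant-gradient letter `α₁` of `X`: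
`‖Ad_{W(z,λ)}(curl_W X)(z+e_λ; μν) − (curl_W X)(z; μν)‖ ≤ (Λ₂⁰ + 128·C_Sε·M²·α₁)∕M³`. [folklore] -/
theorem curl_lipschitz_of_radii [Nonempty n] {W : Site 4 → Fin 4 → (Matrix n n ℂ)ˣ} (hW : IsUnitaryCfg W)
    {X : Site 4 → Fin 4 → Matrix n n ℂ} (hX : IsSkewDir X) {M ε CSε c α α₁ : ℝ} (hM : 1 ≤ M) (hε : 0 ≤ ε) (hC0 : 0 ≤ CSε)
    (hC : CSε ≤ 1 / 48) (hXα : ∀ x κ, ‖X x κ‖ ≤ α) (hαM : α * M ≤ CSε)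
    (hX1 : ∀ (y : Site 4) (κ τ : Fin 4), ‖Ad (W (y + e κ) τ) (X (y + e τ) κ) - X y κ‖ ≤ α₁)
    (hWx : SmallField W (ε / M ^ 2)) (hUx : SmallField (vary W X 1) (ε / M ^ 2))
    (hx₁W : ∀ (p : Site 4) (lam μ ν : Fin 4), μ ≠ ν →
      ‖Ad (W p lam) ((hol W (p + e lam) (plaqWord μ ν) : (Matrix n n ℂ)ˣ) : Matrix n n ℂ) - ((hol W p (plaqWord μ ν) : (Matrix n n ℂ)ˣ) : Matrix n n ℂ)‖
        ≤ 2 * (c + curConst 4 2 * ε ^ 2) / M ^ 3)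
    (hx₁U : ∀ (p : Site 4) (lam μ ν : Fin 4), μ ≠ ν →
      ‖Ad (vary W X 1 p lam) ((hol (vary W X 1) (p + e lam) (plaqWord μ ν) : (Matrix n n ℂ)ˣ) : Matrix n n ℂ)
          - ((hol (vary W X 1) p (plaqWord μ ν) : (Matrix n n ℂ)ˣ) : Matrix n n ℂ)‖ ≤ 2 * c / M ^ 3)
    (z : Site 4) (lam : Fin 4) {μ ν : Fin 4} (hμν : μ ≠ ν) :
    ‖Ad (W z lam) (curlAt W X (z + e lam) μ ν) - curlAt W X z μ ν‖
      ≤ ((10 * c + 6 * curConst 4 2 * ε ^ 2 + 8 * CSε * ε + 4096 * CSε ^ 2 * ε + 1330 * CSε ^ 3) + 128 * CSε * M ^ 2 * α₁) / M ^ 3 := by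
  have hM0 : 0 < M := by linarith
  have hM3 : 0 < M ^ 3 := by positivity
  have hα0 : 0 ≤ α := (norm_nonneg _).trans (hXα z lam)
  have hαle : α ≤ CSε / M := by rw [le_div_iff₀ hM0]; exact hαM
  have hα : α ≤ 1 / 48 := hαle.trans ((div_le_self hC0 hM).trans hC)
  have hx0 : 0 ≤ ε / M ^ 2 := by positivity
  have h := norm_curlGrad_le_of_radii hW hX hXα hα hX1 hx0 hx0 hWx hUx z lam hμν (hx₁W z lam μ ν hμν) (hx₁U z lam μ ν hμν)
  refine h.trans ?_
  have hα₁0 : 0 ≤ α₁ := (norm_nonneg _).trans (hX1 z lam lam)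
  -- every term in the `∕M³` currency
  have hCM : 0 ≤ CSε / M := by positivity
  have t1 : α * (ε / M ^ 2) ≤ (CSε / M) * (ε / M ^ 2) := mul_le_mul_of_nonneg_right hαle hx0
  have t2 : α * α₁ ≤ (CSε / M) * α₁ := mul_le_mul_of_nonneg_right hαle hα₁0
  have hα2 : α ^ 2 ≤ (CSε / M) ^ 2 := pow_le_pow_left₀ hα0 hαle 2
  have hα3 : α ^ 3 ≤ (CSε / M) ^ 3 := pow_le_pow_left₀ hα0 hαle 3
  have t3 : α ^ 2 * (ε / M ^ 2 + ε / M ^ 2) ≤ (CSε / M) ^ 2 * (ε / M ^ 2 + ε / M ^ 2) := mul_le_mul_of_nonneg_right hα2 (by positivity)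
  -- the target in product form
  have erhs : ((10 * c + 6 * curConst 4 2 * ε ^ 2 + 8 * CSε * ε + 4096 * CSε ^ 2 * ε + 1330 * CSε ^ 3) + 128 * CSε * M ^ 2 * α₁) / M ^ 3
      = (10 * c + 6 * curConst 4 2 * ε ^ 2 + 8 * CSε * ε + 4096 * CSε ^ 2 * ε + 1330 * CSε ^ 3) / M ^ 3 + 128 * ((CSε / M) * α₁) := by
    field_simp
  rw [erhs]
  have e1 : (CSε / M) * (ε / M ^ 2) = CSε * ε / M ^ 3 := by field_simp
  have e3 : (CSε / M) ^ 2 * (ε / M ^ 2 + ε / M ^ 2) = 2 * CSε ^ 2 * ε / M ^ 4 := by field_simp; ring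
  have e4 : (CSε / M) ^ 3 = CSε ^ 3 / M ^ 3 := by rw [div_pow]
  rw [e1] at t1
  rw [e3] at t3
  rw [e4] at hα3
  -- `1∕M⁴ ≤ 1∕M³` (with `ε ≤ 1` not even needed: the same power of `ε` on both sides)
  have hM43 : 2 * CSε ^ 2 * ε / M ^ 4 ≤ 2 * CSε ^ 2 * ε / M ^ 3 := by
    refine div_le_div_of_nonneg_left (by positivity) hM3 ?_
    calc M ^ 3 = M ^ 3 * 1 := (mul_one _).symm
      _ ≤ M ^ 3 * M := mul_le_mul_of_nonneg_left hM hM3.le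
      _ = M ^ 4 := by ring
  have hsum : 2 * (2 * c / M ^ 3) + 3 * (2 * (c + curConst 4 2 * ε ^ 2) / M ^ 3) + 8 * (CSε * ε / M ^ 3) + 2048 * (2 * CSε ^ 2 * ε / M ^ 3)
      + 1330 * (CSε ^ 3 / M ^ 3) = (10 * c + 6 * curConst 4 2 * ε ^ 2 + 8 * CSε * ε + 4096 * CSε ^ 2 * ε + 1330 * CSε ^ 3) / M ^ 3 := by
    field_simp; ring
  linarith [t1, t2, t3, hα3, hM43, hsum]

/-! ## §2 The sup of the dressed curl at the rate `θ^{42k}` -/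

set_option maxHeartbeats 400000 in
/-- **THE SUP OF THE DRESSED CURL AT THE RATE `θ^{42k}`** (statement in the file header; `d = 4`, `L = 2`, level `j+1`, `M = 2^{j+1}`, `θ^{18} = 2⁻¹`). [folklore] -/
theorem curl_sup_rate [Nonempty n] {N : ℕ} (hN : 1 ≤ N) (j : ℕ) {ε CSε c : ℝ} (hε : 0 < ε) (hC0 : 0 ≤ CSε) (hC : CSε ≤ 1 / 48)
    {W : Site 4 → Fin 4 → (Matrix n n ℂ)ˣ} (hWu : IsUnitaryCfg W) (hWP : IsPeriodicCfg W ((N * 2 ^ (j + 1) : ℕ) : ℤ))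
    (hWx : SmallField W (ε / (((2 : ℕ) : ℝ) ^ (j + 1)) ^ 2))
    {X : Site 4 → Fin 4 → Matrix n n ℂ} (hXs : IsSkewDir X) (hXP : IsPeriodicDir X ((N * 2 ^ (j + 1) : ℕ) : ℤ)) {α : ℝ}
    (hXα : ∀ x κ, ‖X x κ‖ ≤ α) (hαM : α * ((2 : ℕ) : ℝ) ^ (j + 1) ≤ CSε) (hUx : SmallField (vary W X 1) (ε / (((2 : ℕ) : ℝ) ^ (j + 1)) ^ 2))
    {γ : ℝ} (hγ : 0 < γ) (hEγ : ((2 : ℕ) : ℝ) ^ (j + 1) * energyNormW 2 (j + 1) W X (periodBox (d := 4) (N * 2 ^ (j + 1))) ≤ γ ^ 3)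
    (hx₁W : ∀ (p : Site 4) (lam μ ν : Fin 4), μ ≠ ν →
      ‖Ad (W p lam) ((hol W (p + e lam) (plaqWord μ ν) : (Matrix n n ℂ)ˣ) : Matrix n n ℂ) - ((hol W p (plaqWord μ ν) : (Matrix n n ℂ)ˣ) : Matrix n n ℂ)‖
        ≤ 2 * (c + curConst 4 2 * ε ^ 2) / (((2 : ℕ) : ℝ) ^ (j + 1)) ^ 3)
    (hx₁U : ∀ (p : Site 4) (lam μ ν : Fin 4), μ ≠ ν →
      ‖Ad (vary W X 1 p lam) ((hol (vary W X 1) (p + e lam) (plaqWord μ ν) : (Matrix n n ℂ)ˣ) : Matrix n n ℂ)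
          - ((hol (vary W X 1) p (plaqWord μ ν) : (Matrix n n ℂ)ˣ) : Matrix n n ℂ)‖ ≤ 2 * c / (((2 : ℕ) : ℝ) ^ (j + 1)) ^ 3)
    {α₁ : ℝ} (hX1 : ∀ (y : Site 4) (κ τ : Fin 4), ‖Ad (W (y + e κ) τ) (X (y + e τ) κ) - X y κ‖ ≤ α₁)
    {l₂ : ℝ} (hl₂ : 0 < l₂) (hγl : γ ≤ l₂)
    (hΛ : (10 * c + 6 * curConst 4 2 * ε ^ 2 + 8 * CSε * ε + 4096 * CSε ^ 2 * ε + 1330 * CSε ^ 3) + 128 * CSε * (((2 : ℕ) : ℝ) ^ (j + 1)) ^ 2 * α₁ ≤ l₂ ^ 3)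
    {θ : ℝ} (hθ : 0 < θ) (hθ18 : θ ^ 18 = (((2 : ℕ) : ℝ))⁻¹)
    (z : Site 4) {μ ν : Fin 4} (hμν : μ ≠ ν) :
    ‖curlAt W X z μ ν‖ ≤ 8 * l₂ ^ 2 * γ * θ ^ (42 * (j + 1)) := by
  set M : ℝ := ((2 : ℕ) : ℝ) ^ (j + 1) with hM
  have hM1 : 1 ≤ M := one_le_pow₀ (by norm_num)
  have hM0 : 0 < M := by positivity
  have hθ1 : θ < 1 := theta18_lt_one (le_refl 2) hθ18
  -- the Lipschitz letter at every bond, in the `(2⁻¹)^k` currency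
  have hξ : (((2 : ℕ) : ℝ)⁻¹) ^ (j + 1) = M⁻¹ := by rw [hM, inv_pow]
  have hlip : ∀ (π : T4AveragingDeficitWall.Plane 4) (x : Site 4) (ρ : Fin 4),
      ‖Ad (W x ρ) (curl W X (x + e ρ, π)) - curl W X (x, π)‖ ≤ l₂ ^ 3 * ((((2 : ℕ) : ℝ)⁻¹) ^ (j + 1)) ^ 3 := by
    intro π x ρ
    have hne : π.1.1 ≠ π.1.2 := ne_of_lt π.2
    have h := curl_lipschitz_of_radii hWu hXs hM1 hε.le hC0 hC hXα hαM hX1 hWx hUx hx₁W hx₁U x ρ hne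
    refine h.trans ?_
    rw [hξ, inv_pow, div_eq_mul_inv]
    exact mul_le_mul_of_nonneg_right hΛ (by positivity)
  -- gen 22's local-average lemma at `θ₆ := θ³`
  have hθ6 : (θ ^ 3) ^ 6 = (((2 : ℕ) : ℝ))⁻¹ := by rw [← pow_mul]; exact hθ18
  have hθ3 : 0 < θ ^ 3 := pow_pos hθ 3
  have hfit : γ * ((θ ^ 3) ^ (j + 1)) ^ 2 ≤ l₂ * N := by
    have h1 : ((θ ^ 3) ^ (j + 1)) ^ 2 ≤ 1 := pow_le_one₀ (by positivity) (pow_le_one₀ hθ3.le (pow_le_one₀ hθ.le hθ1.le))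
    have hN1 : (1 : ℝ) ≤ N := by exact_mod_cast hN
    calc γ * ((θ ^ 3) ^ (j + 1)) ^ 2 ≤ γ * 1 := mul_le_mul_of_nonneg_left h1 hγ.le
      _ ≤ l₂ * N := by rw [mul_one]; exact hγl.trans (le_mul_of_one_le_right hl₂.le hN1)
  have hplaq : ∀ p : T4AveragingDeficitWall.Plaq 4, ‖curl W X p‖ ≤ 8 * l₂ ^ 2 * γ * θ ^ (42 * (j + 1)) := by
    rintro ⟨x, π⟩
    have h := norm_curl_le_rate_cov (L := 2) (N := N) (k := j + 1) (le_refl 2) hN (by omega) hθ3 hθ6 hWu hWP hXP hγ hl₂ le_rfl hEγ π (hlip π) hfit x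
    rw [← pow_mul, show 3 * (14 * (j + 1)) = 42 * (j + 1) by ring] at h
    exact h
  exact norm_curlAt_le_of_plaq hWu hplaq z hμν

end

end Summit.QuantumFields.BalabanUV.T4Continuum.NE7PairCurlSupRate
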